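import Mathlib
import Literature.Analysis.FluidPDE.VectorCalculus

/-!
# STUB R from an EDGE-MEASURE CERTIFICATE: the cokernel certificate of `…Clause13RCokernelCertificate` with ATOMS at in-ball stations
# (crux `Clause13RNearStraightL`, stmt-NavierStokesRegularity-23612; line `rate_bordered_split`, STUB R `stub_rateRow13RFlat`)

Route `FilamentSkeletonRss`, Variant A1R.  `…Clause13RCokernelCertificate.rateRow13RFlat_of_cokernelCertificate` (fsrs-8-g1) and
`…Clause13RAdjointKernelCertificate` (fsrs-10-g0) reduce the registered STUB R to an annihilator of `range DT` on the tangency balls that is an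
absolutely continuous weight `ψ ∈ C⁰` / `C¹`.  The energy identity `…Clause13RAdjointEnergy.model_adjoint_no_regular_annihilator` (this hand)
shows that in the MODEL no such weight exists (`w′ > −1`): the annihilators of the range on the CLAMPED test class are measures with ATOMS at the
ball edge (where the test field and its first two derivatives vanish, `…Clause13REdgeClamping`) plus an interior density solving the SOURCED adjoint
equation.  THIS FILE re-types the duality interface accordingly:

* **`rateRow13RFlat_of_edgeMeasureCertificate` : EDGE-MEASURE CERTIFICATE ⟹ STUB R (verbatim text of the registered `RateRow13RFlat`)**, where the
  certificate is the cokernel certificate with, in addition to the continuous weights `ψ_j` on the balls `S_j = {‖X_j τ‖ ≤ R_b√(Γ log Γ)}`, finitely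
  many ATOMS — in-ball stations `t_i` on filaments `ι_i` carrying vectors `e_i` — entering the mass `M = Σ_j∫_{S_j}‖ψ_j‖ + Σ_i‖e_i‖ > 0`, the pairing
  floor `(√Γ/cnd)·M ≤ Σ_j∫_{S_j}⟪ψ_j, R_j⟫ + Σ_i⟪e_i, R_{ι_i}(t_i)⟫` and the exact annihilation `Σ_j∫_{S_j}⟪ψ_j, DT·Y_j⟫ + Σ_i⟪e_i, DT·Y_{ι_i}(t_i)⟫ = 0`
  for every admissible `Y` (`C²`, normal, zero off the balls, phase-orthogonal).  Proof: the same three lines of soft duality (`dα·P = ` pairing of the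
  measure with `dα R − DT·Y`, bounded by `L·M` through the in-ball defect bound at every `τ ∈ S_j` and every `t_i`; `M > 0`).  `m = 0` recovers the
  cokernel certificate.
So the open content of STUB R along the duality route is now: construct such an edge measure (model first: atoms `e_±` at the two exit stations and the
density solving the model adjoint equation sourced by the edge kernels `c·k(τ_± − σ)Je_±`, unique by `…Clause13RAdjointEnergy.model_adjoint_apriori`),
with the pairing floor carried by the atoms (`‖R_j(τ_±)‖ ≳ R_b√(Γ log Γ)·√(θ₀(2−θ₀))`, `…Clause13REdgeClamping.edgeRow`).
Hand `leafhand-ns-filamentskeletonrs-16-g0` (LAND-ONLY); `--supports stmt-NavierStokesRegularity-23612` helper, def-free.  HONEST FRAMING: soft duality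
bookkeeping about the registered statement of a clause on a HYPOTHETICAL near-straight filament skeleton on the NEGATIVE side of a MODEL blow-up route;
STUB R is NOT proved here (no measure is constructed) and nothing in this file bears on Navier–Stokes regularity or blow-up.
-/

noncomputable section

open Real Filter MeasureTheory Literature.Analysis.FluidPDE
open scoped RealInnerProductSpace InnerProductSpace Topology BigOperators
namespace Summit.NavierStokesRegularity.NavierStokesRegularity.Theorems.Clause13REdgeMeasureCertificate
set_option linter.dupNamespace false

/-- One atom: `|⟪e, dα•R − D⟫| ≤ ‖e‖·L` from the in-ball defect bound `‖D − dα•R‖ ≤ L`. [folklore] -/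
theorem abs_inner_atom_le {e R D : EuclideanSpace ℝ (Fin 3)} {dα L : ℝ} (h : ‖D - dα • R‖ ≤ L) :
    |⟪e, dα • R - D⟫_ℝ| ≤ ‖e‖ * L := by
  calc |⟪e, dα • R - D⟫_ℝ| ≤ ‖e‖ * ‖dα • R - D‖ := abs_real_inner_le_norm _ _
    _ ≤ ‖e‖ * L := by
        refine mul_le_mul_of_nonneg_left ?_ (norm_nonneg _)
        rwa [← norm_neg, neg_sub]

/-- **EDGE-MEASURE CERTIFICATE ⟹ STUB R** (`RateRow13RFlat` of the registered line, verbatim conclusion).  The hypothesis is the cokernel certificate of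
`…Clause13RCokernelCertificate.rateRow13RFlat_of_cokernelCertificate` enriched by finitely many atoms `(ι_i, t_i, e_i)` at in-ball stations (mass, pairing
floor and annihilation all include the atoms). [folklore] -/
theorem rateRow13RFlat_of_edgeMeasureCertificate :
    ((open Literature.Analysis.FluidPDE in ∀ (N : ℕ) (δ ρ K Λ Rw cg θ₀ KA : ℝ), 0 < N → 0 < δ → 0 < ρ → 0 < Rw → 0 < cg → 0 < θ₀ → ∃ Rb₀ : ℝ, 0 < Rb₀ ∧ ∀ Rb : ℝ, 0 < Rb → Rb ≤ Rb₀ → ∃ (cnd Γ₀ : ℝ), 0 < cnd ∧ ∀ Γ : ℝ, Γ₀ ≤ Γ → ∀ (γ : Fin N → ℝ) (α : ℝ) (X : Fin N → ℝ → EuclideanSpace ℝ (Fin 3)) (w : Fin N → ℝ → ℝ) (c : Fin N → ℝ) (Aa : Fin N → ℝ → ℝ), (∀ (u:(Fin N → ℝ → EuclideanSpace ℝ (Fin 3)) → EuclideanSpace ℝ (Fin 3) → EuclideanSpace ℝ (Fin 3)) (v:EuclideanSpace ℝ (Fin 3) → EuclideanSpace ℝ (Fin 3)) (A:Fin N → (EuclideanSpace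 ℝ (Fin 3) →L[ℝ] EuclideanSpace ℝ (Fin 3))) (T:(Fin N → ℝ → EuclideanSpace ℝ (Fin 3)) → Fin N → ℝ → EuclideanSpace ℝ (Fin 3)), (∀ Z y, u Z y = ∑ k, (Γ*γ k/(4*Real.pi))•∫ σ:ℝ, ((‖y-Z k σ‖^2+Real.exp (-(1+Real.eulerMascheroniConstant-Real.log 2))*Aa k σ)^(3/2:ℝ))⁻¹•cross (deriv (Z k) σ) (y-Z k σ))→(∀ y, v y = u X y+(1/2:ℝ)•y-α•cross (EuclideanSpace.single 2 1) y)→(∀ j, A j = fderiv ℝ v (X j (c j)))→(∀ Z j τ, T Z j τ = (u Z (Z j τ)+(1/2:ℝ)•Z j τ-α•cross (EuclideanSpace.single 2 1) (Z j τ))-(⟪u Z (Z j τ)+(1/2:ℝ)•Z j τ-α•cross (EuclideanSpace.single 2 1) (Z j τ), deriv (Z j) τ⟫_ℝ/‖deriv (Z j) τ‖^2)•deriv (Z j) τ)→(α ≠ 0 ∧ (∀ j, γ j ≠ 0) ∧ (∀ j, ContDiff ℝ 2 (X j) ∧ Differentiable ℝ (w j)∧(∀ τ, ‖deriv (X j)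 τ‖ = 1)∧(∀ τ, ‖iteratedDeriv 2 (X j) τ‖*√Γ≤K) ∧ Tendsto (fun τ => ‖X j τ‖) (cocompact ℝ) atTop) ∧ (∀ j k, j ≠ k → ∀ τ σ, ρ*√Γ≤‖X j τ-X k σ‖) ∧ (∀ j τ σ, ρ*√Γ≤|τ-σ| → cg*ρ*√Γ≤‖X j τ-X j σ‖) ∧ (∀ j τ, cg*|τ-c j|≤Rw*√Γ+‖X j τ‖) ∧ (∀ j τ, w j τ = ⟪v (X j τ), deriv (X j) τ⟫_ℝ) ∧ (∀ j τ, ‖X j τ‖≤Rb*√(Γ*Real.log Γ) → v (X j τ) = w j τ•deriv (X j) τ) ∧ (∀ j, ‖X j (c j)‖≤Rw*√Γ) ∧ (∀ j, |⟪deriv (X j) (c j), EuclideanSpace.single 2 1⟫_ℝ|≤1-θ₀) ∧ (θ₀≤|α| ∧ |α|≤θ₀⁻¹ ∧ ∀ j, θ₀≤|γ j| ∧ |γ j|≤θ₀⁻¹) ∧ (∀ j, w j (c j) = 0 ∧ (∀ τ, w j τ = 0 → τ = c j) ∧ 3/2+δ≤deriv (w j) (c j) ∧ deriv (w j) (c j)≤Λ)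 ∧ (∀ j, Differentiable ℝ (Aa j) ∧ (∀ τ, 0 < Aa j τ) ∧ 1≤KA*Aa j (c j) ∧ ∀ τ, ‖X j τ‖≤2*Rb*√(Γ*Real.log Γ) → Aa j τ = Aa j (c j)) ∧ (∀ j τ, Rw^2*Γ*Aa j τ≤KA*(Rw^2*Γ+‖X j τ‖^2)))) → ((∀ j τ σ, ‖deriv (X j) τ - deriv (X j) σ‖ ≤ Rb) ∧ (∀ j τ, |deriv (w j) τ| ≤ Λ) ∧ (∀ j τ, Λ⁻¹ ≤ Aa j τ)) → (∀ (u:(Fin N → ℝ → EuclideanSpace ℝ (Fin 3)) → EuclideanSpace ℝ (Fin 3) → EuclideanSpace ℝ (Fin 3)) (v:EuclideanSpace ℝ (Fin 3) → EuclideanSpace ℝ (Fin 3)) (A:Fin N → (EuclideanSpace ℝ (Fin 3) →L[ℝ] EuclideanSpace ℝ (Fin 3))) (T:(Fin N → ℝ → EuclideanSpace ℝ (Fin 3)) → Fin N → ℝ → EuclideanSpace ℝ (Fin 3)), (∀ Z y, u Z y = ∑ k, (Γ*γ k/(4*Real.pi))•∫ σ:ℝ, ((‖y-Z k σ‖^2+Real.exp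 (-(1+Real.eulerMascheroniConstant-Real.log 2))*Aa k σ)^(3/2:ℝ))⁻¹•cross (deriv (Z k) σ) (y-Z k σ))→(∀ y, v y = u X y+(1/2:ℝ)•y-α•cross (EuclideanSpace.single 2 1) y)→(∀ j, A j = fderiv ℝ v (X j (c j)))→(∀ Z j τ, T Z j τ = (u Z (Z j τ)+(1/2:ℝ)•Z j τ-α•cross (EuclideanSpace.single 2 1) (Z j τ))-(⟪u Z (Z j τ)+(1/2:ℝ)•Z j τ-α•cross (EuclideanSpace.single 2 1) (Z j τ), deriv (Z j) τ⟫_ℝ/‖deriv (Z j) τ‖^2)•deriv (Z j) τ)→(∃ (ψ : Fin N → ℝ → EuclideanSpace ℝ (Fin 3)) (m : ℕ) (ι : Fin m → Fin N) (t : Fin m → ℝ) (e : Fin m → EuclideanSpace ℝ (Fin 3)), (∀ j, Continuous (ψ j)) ∧ (∀ i, ‖X (ι i) (t i)‖ ≤ Rb*√(Γ*Real.log Γ)) ∧ (0 < (∑ j, ∫ τ in {τ : ℝ | ‖X j τ‖ ≤ Rb*√(Γ*Real.log Γ)}, ‖ψ j τ‖) + ∑ i, ‖e i‖) ∧ (√Γ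 / cnd * ((∑ j, ∫ τ in {τ : ℝ | ‖X j τ‖ ≤ Rb*√(Γ*Real.log Γ)}, ‖ψ j τ‖) + ∑ i, ‖e i‖) ≤ (∑ j, ∫ τ in {τ : ℝ | ‖X j τ‖ ≤ Rb*√(Γ*Real.log Γ)}, ⟪ψ j τ, (cross (EuclideanSpace.single 2 1) (X j τ)-⟪cross (EuclideanSpace.single 2 1) (X j τ), deriv (X j) τ⟫_ℝ•deriv (X j) τ)⟫_ℝ) + ∑ i, ⟪e i, (cross (EuclideanSpace.single 2 1) (X (ι i) (t i))-⟪cross (EuclideanSpace.single 2 1) (X (ι i) (t i)), deriv (X (ι i)) (t i)⟫_ℝ•deriv (X (ι i)) (t i))⟫_ℝ) ∧ ∀ Y:Fin N → ℝ → EuclideanSpace ℝ (Fin 3), (∀ j, ContDiff ℝ 2 (Y j))→(∀ j τ, ⟪Y j τ, deriv (X j) τ⟫_ℝ = 0) → (∀ j τ, Rb*√(Γ*Real.log Γ) < ‖X j τ‖ → Y j τ = 0) → ∑ j, ⟪Y j (c j), cross (EuclideanSpace.single 2 1) (X j (c j))⟫_ℝ = 0 → ((∀ j, MeasureTheory.IntegrableOn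 (fun τ => ⟪ψ j τ, deriv (fun s:ℝ => T (fun k σ => X k σ+s•Y k σ) j τ) 0⟫_ℝ) {τ : ℝ | ‖X j τ‖ ≤ Rb*√(Γ*Real.log Γ)}) ∧ (∑ j, ∫ τ in {τ : ℝ | ‖X j τ‖ ≤ Rb*√(Γ*Real.log Γ)}, ⟪ψ j τ, deriv (fun s:ℝ => T (fun k σ => X k σ+s•Y k σ) j τ) 0⟫_ℝ) + ∑ i, ⟪e i, deriv (fun s:ℝ => T (fun k σ => X k σ+s•Y k σ) (ι i) (t i)) 0⟫_ℝ = 0))))) →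
    ((open Literature.Analysis.FluidPDE in ∀ (N : ℕ) (δ ρ K Λ Rw cg θ₀ KA : ℝ), 0 < N → 0 < δ → 0 < ρ → 0 < Rw → 0 < cg → 0 < θ₀ → ∃ Rb₀ : ℝ, 0 < Rb₀ ∧ ∀ Rb : ℝ, 0 < Rb → Rb ≤ Rb₀ → ∀ b : ℝ, ∃ (cnd Γ₀ : ℝ), 0 < cnd ∧ ∀ Γ : ℝ, Γ₀ ≤ Γ → ∀ (γ : Fin N → ℝ) (α : ℝ) (X : Fin N → ℝ → EuclideanSpace ℝ (Fin 3)) (w : Fin N → ℝ → ℝ) (c : Fin N → ℝ) (Aa : Fin N → ℝ → ℝ), (∀ (u:(Fin N → ℝ → EuclideanSpace ℝ (Fin 3)) → EuclideanSpace ℝ (Fin 3) → EuclideanSpace ℝ (Fin 3)) (v:EuclideanSpace ℝ (Fin 3) → EuclideanSpace ℝ (Fin 3)) (A:Fin N → (EuclideanSpace ℝ (Fin 3) →L[ℝ] EuclideanSpace ℝ (Fin 3))) (T:(Fin N → ℝ → EuclideanSpace ℝ (Fin 3)) → Fin N → ℝ → EuclideanSpace ℝ (Fin 3)), (∀ Z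 y, u Z y = ∑ k, (Γ*γ k/(4*Real.pi))•∫ σ:ℝ, ((‖y-Z k σ‖^2+Real.exp (-(1+Real.eulerMascheroniConstant-Real.log 2))*Aa k σ)^(3/2:ℝ))⁻¹•cross (deriv (Z k) σ) (y-Z k σ))→(∀ y, v y = u X y+(1/2:ℝ)•y-α•cross (EuclideanSpace.single 2 1) y)→(∀ j, A j = fderiv ℝ v (X j (c j)))→(∀ Z j τ, T Z j τ = (u Z (Z j τ)+(1/2:ℝ)•Z j τ-α•cross (EuclideanSpace.single 2 1) (Z j τ))-(⟪u Z (Z j τ)+(1/2:ℝ)•Z j τ-α•cross (EuclideanSpace.single 2 1) (Z j τ), deriv (Z j) τ⟫_ℝ/‖deriv (Z j) τ‖^2)•deriv (Z j) τ)→(α ≠ 0 ∧ (∀ j, γ j ≠ 0) ∧ (∀ j, ContDiff ℝ 2 (X j) ∧ Differentiable ℝ (w j)∧(∀ τ, ‖deriv (X j) τ‖ = 1)∧(∀ τ, ‖iteratedDeriv 2 (X j) τ‖*√Γ≤K) ∧ Tendsto (fun τ => ‖X j τ‖) (cocompact ℝ) atTop) ∧ (∀ j k, j ≠ k → ∀ τ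 σ, ρ*√Γ≤‖X j τ-X k σ‖) ∧ (∀ j τ σ, ρ*√Γ≤|τ-σ| → cg*ρ*√Γ≤‖X j τ-X j σ‖) ∧ (∀ j τ, cg*|τ-c j|≤Rw*√Γ+‖X j τ‖) ∧ (∀ j τ, w j τ = ⟪v (X j τ), deriv (X j) τ⟫_ℝ) ∧ (∀ j τ, ‖X j τ‖≤Rb*√(Γ*Real.log Γ) → v (X j τ) = w j τ•deriv (X j) τ) ∧ (∀ j, ‖X j (c j)‖≤Rw*√Γ) ∧ (∀ j, |⟪deriv (X j) (c j), EuclideanSpace.single 2 1⟫_ℝ|≤1-θ₀) ∧ (θ₀≤|α| ∧ |α|≤θ₀⁻¹ ∧ ∀ j, θ₀≤|γ j| ∧ |γ j|≤θ₀⁻¹) ∧ (∀ j, w j (c j) = 0 ∧ (∀ τ, w j τ = 0 → τ = c j) ∧ 3/2+δ≤deriv (w j) (c j) ∧ deriv (w j) (c j)≤Λ) ∧ (∀ j, Differentiable ℝ (Aa j) ∧ (∀ τ, 0 < Aa j τ) ∧ 1≤KA*Aa j (c j) ∧ ∀ τ, ‖X j τ‖≤2*Rb*√(Γ*Real.log Γ)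 → Aa j τ = Aa j (c j)) ∧ (∀ j τ, Rw^2*Γ*Aa j τ≤KA*(Rw^2*Γ+‖X j τ‖^2)))) → ((∀ j τ σ, ‖deriv (X j) τ - deriv (X j) σ‖ ≤ Rb) ∧ (∀ j τ, |deriv (w j) τ| ≤ Λ) ∧ (∀ j τ, Λ⁻¹ ≤ Aa j τ)) → (∀ (u:(Fin N → ℝ → EuclideanSpace ℝ (Fin 3)) → EuclideanSpace ℝ (Fin 3) → EuclideanSpace ℝ (Fin 3)) (v:EuclideanSpace ℝ (Fin 3) → EuclideanSpace ℝ (Fin 3)) (A:Fin N → (EuclideanSpace ℝ (Fin 3) →L[ℝ] EuclideanSpace ℝ (Fin 3))) (T:(Fin N → ℝ → EuclideanSpace ℝ (Fin 3)) → Fin N → ℝ → EuclideanSpace ℝ (Fin 3)), (∀ Z y, u Z y = ∑ k, (Γ*γ k/(4*Real.pi))•∫ σ:ℝ, ((‖y-Z k σ‖^2+Real.exp (-(1+Real.eulerMascheroniConstant-Real.log 2))*Aa k σ)^(3/2:ℝ))⁻¹•cross (deriv (Z k) σ) (y-Z k σ))→(∀ y, v y = u X y+(1/2:ℝ)•y-α•cross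 (EuclideanSpace.single 2 1) y)→(∀ j, A j = fderiv ℝ v (X j (c j)))→(∀ Z j τ, T Z j τ = (u Z (Z j τ)+(1/2:ℝ)•Z j τ-α•cross (EuclideanSpace.single 2 1) (Z j τ))-(⟪u Z (Z j τ)+(1/2:ℝ)•Z j τ-α•cross (EuclideanSpace.single 2 1) (Z j τ), deriv (Z j) τ⟫_ℝ/‖deriv (Z j) τ‖^2)•deriv (Z j) τ)→(∀ Y:Fin N → ℝ → EuclideanSpace ℝ (Fin 3), (∀ j, ContDiff ℝ 2 (Y j))→(∀ j τ, ⟪Y j τ, deriv (X j) τ⟫_ℝ = 0) → (∀ j τ, Rb*√(Γ*Real.log Γ) < ‖X j τ‖ → Y j τ = 0) → ∑ j, ⟪Y j (c j), cross (EuclideanSpace.single 2 1) (X j (c j))⟫_ℝ = 0 → (∀ j τ, ‖Y j τ‖+‖deriv (Y j) τ‖+‖iteratedDeriv 2 (Y j) τ‖≤(1+|τ-c j|)^b) → ∀ dα L:ℝ, (∀ j τ, ‖X j τ‖≤Rb*√(Γ*Real.log Γ) → ‖deriv (fun s:ℝ => T (fun k σ => X k σ+s•Y k σ) j τ) 0-dα•(cross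 (EuclideanSpace.single 2 1) (X j τ)-⟪cross (EuclideanSpace.single 2 1) (X j τ), deriv (X j) τ⟫_ℝ•deriv (X j) τ)‖≤L) → |dα| * √Γ≤cnd*L)))) := by
  intro hC N δ ρ K Λ Rw cg θ₀ KA hN hδ hρ hRw hcg hθ₀
  obtain ⟨Rb₀, hRb₀, hfam⟩ := hC N δ ρ K Λ Rw cg θ₀ KA hN hδ hρ hRw hcg hθ₀
  refine ⟨Rb₀, hRb₀, fun Rb hRb hRble b => ?_⟩
  obtain ⟨cnd, Γ₀, hcnd, hΓ⟩ := hfam Rb hRb hRble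
  refine ⟨cnd, Γ₀, hcnd, fun Γ hΓle => ?_⟩
  intro γ α X w c Aa hH hNS u v A T hu hv hA hT Y hY2 hYn hYoff hYph _henv dα L hdef
  obtain ⟨ψ, m, ι, t, e, hψc, hint_t, hMpos, hpair, hann⟩ := hΓ Γ hΓle γ α X w c Aa hH hNS u v A T hu hv hA hT
  obtain ⟨hint, hzero⟩ := hann Y hY2 hYn hYoff hYph
  obtain ⟨-, -, h3, -⟩ := hH u v A T hu hv hA hT
  -- notation
  set S : Fin N → Set ℝ := fun j => {τ : ℝ | ‖X j τ‖ ≤ Rb * √(Γ * Real.log Γ)} with hS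
  set Rcol : Fin N → ℝ → EuclideanSpace ℝ (Fin 3) := fun j τ =>
    cross (EuclideanSpace.single 2 1) (X j τ) - ⟪cross (EuclideanSpace.single 2 1) (X j τ), deriv (X j) τ⟫_ℝ • deriv (X j) τ with hRcol
  set D : Fin N → ℝ → EuclideanSpace ℝ (Fin 3) := fun j τ =>
    deriv (fun s:ℝ => T (fun k σ => X k σ + s • Y k σ) j τ) 0 with hD
  set Mψ : ℝ := ∑ j, ∫ τ in S j, ‖ψ j τ‖ with hMψ
  set Me : ℝ := ∑ i, ‖e i‖ with hMe
  set M : ℝ := Mψ + Me with hM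
  set Pψ : ℝ := ∑ j, ∫ τ in S j, ⟪ψ j τ, Rcol j τ⟫_ℝ with hPψ
  set Pe : ℝ := ∑ i, ⟪e i, Rcol (ι i) (t i)⟫_ℝ with hPe
  set P : ℝ := Pψ + Pe with hP
  -- compactness / measurability / integrability on the balls (the soft lemmas of `…Clause13RCokernelCertificate`, inlined to keep this file
  -- outside the route cone)
  have hScpt : ∀ j, IsCompact (S j) := by
    intro j
    have hXc : Continuous (X j) := (h3 j).1.continuous
    obtain ⟨K', hK', hKsub⟩ := mem_cocompact.1 ((h3 j).2.2.2.2.eventually (eventually_gt_atTop (Rb * √(Γ * Real.log Γ))))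
    refine hK'.of_isClosed_subset (isClosed_le (continuous_norm.comp hXc) continuous_const) ?_
    intro τ hτ
    by_contra hn
    have h' : Rb * √(Γ * Real.log Γ) < ‖X j τ‖ := hKsub hn
    exact not_lt.2 hτ h'
  have hSmeas : ∀ j, MeasurableSet (S j) := fun j =>
    (isClosed_le (continuous_norm.comp (h3 j).1.continuous) continuous_const).measurableSet
  have hRcolc : ∀ j, Continuous (Rcol j) := by
    intro j
    have hXc : Continuous (X j) := (h3 j).1.continuous
    have hd : Continuous (deriv (X j)) := (h3 j).1.continuous_deriv (by norm_num)
    have hc : Continuous fun τ => cross (EuclideanSpace.single 2 1) (X j τ) :=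
      (crossCLM (EuclideanSpace.single 2 1 : EuclideanSpace ℝ (Fin 3))).continuous.comp hXc
    have hi : Continuous fun τ => ⟪cross (EuclideanSpace.single 2 1) (X j τ), deriv (X j) τ⟫_ℝ := hc.inner hd
    have hs : Continuous fun τ => ⟪cross (EuclideanSpace.single 2 1) (X j τ), deriv (X j) τ⟫_ℝ • deriv (X j) τ := hi.smul hd
    exact hc.sub hs
  have hRint : ∀ j, IntegrableOn (fun τ => ⟪ψ j τ, Rcol j τ⟫_ℝ) (S j) := fun j =>
    ((hψc j).inner (hRcolc j)).continuousOn.integrableOn_compact (hScpt j)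
  have hNint : ∀ j, IntegrableOn (fun τ => ‖ψ j τ‖ * L) (S j) := fun j =>
    ((hψc j).norm.mul continuous_const).continuousOn.integrableOn_compact (hScpt j)
  -- (1) the pairing of the measure with `dα R − D` equals `dα·P` (annihilation)
  have h1ψ : ∑ j, ∫ τ in S j, ⟪ψ j τ, dα • Rcol j τ - D j τ⟫_ℝ = dα * Pψ - ∑ j, ∫ τ in S j, ⟪ψ j τ, D j τ⟫_ℝ := by
    have hsplit : ∀ j, ∫ τ in S j, ⟪ψ j τ, dα • Rcol j τ - D j τ⟫_ℝ
        = dα * (∫ τ in S j, ⟪ψ j τ, Rcol j τ⟫_ℝ) - ∫ τ in S j, ⟪ψ j τ, D j τ⟫_ℝ := by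
      intro j
      have hcongr : (fun τ => ⟪ψ j τ, dα • Rcol j τ - D j τ⟫_ℝ)
          = fun τ => dα * ⟪ψ j τ, Rcol j τ⟫_ℝ - ⟪ψ j τ, D j τ⟫_ℝ := by
        funext τ; rw [inner_sub_right, real_inner_smul_right]
      rw [hcongr, integral_sub ((hRint j).const_mul dα) (hint j), integral_const_mul]
    rw [Finset.sum_congr rfl fun j _ => hsplit j, Finset.sum_sub_distrib, hPψ, Finset.mul_sum]
  have h1e : ∑ i, ⟪e i, dα • Rcol (ι i) (t i) - D (ι i) (t i)⟫_ℝ = dα * Pe - ∑ i, ⟪e i, D (ι i) (t i)⟫_ℝ := by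
    have hcongr : ∀ i, ⟪e i, dα • Rcol (ι i) (t i) - D (ι i) (t i)⟫_ℝ
        = dα * ⟪e i, Rcol (ι i) (t i)⟫_ℝ - ⟪e i, D (ι i) (t i)⟫_ℝ := by
      intro i; rw [inner_sub_right, real_inner_smul_right]
    rw [Finset.sum_congr rfl fun i _ => hcongr i, Finset.sum_sub_distrib, hPe, Finset.mul_sum]
  have h1 : (∑ j, ∫ τ in S j, ⟪ψ j τ, dα • Rcol j τ - D j τ⟫_ℝ) + ∑ i, ⟪e i, dα • Rcol (ι i) (t i) - D (ι i) (t i)⟫_ℝ = dα * P := by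
    rw [h1ψ, h1e, hP]
    have hz : (∑ j, ∫ τ in S j, ⟪ψ j τ, D j τ⟫_ℝ) + ∑ i, ⟪e i, D (ι i) (t i)⟫_ℝ = 0 := by
      simpa [hD, hS] using hzero
    linear_combination (-1 : ℝ) * hz
  -- (2) the pairing is bounded by `L·M` (in-ball defect bound at every `τ ∈ S_j` and at every atom)
  have h2ψ : |∑ j, ∫ τ in S j, ⟪ψ j τ, dα • Rcol j τ - D j τ⟫_ℝ| ≤ L * Mψ := by
    calc |∑ j, ∫ τ in S j, ⟪ψ j τ, dα • Rcol j τ - D j τ⟫_ℝ|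
        ≤ ∑ j, |∫ τ in S j, ⟪ψ j τ, dα • Rcol j τ - D j τ⟫_ℝ| := Finset.abs_sum_le_sum_abs _ _
      _ ≤ ∑ j, ∫ τ in S j, ‖ψ j τ‖ * L := by
          refine Finset.sum_le_sum fun j _ => ?_
          rw [← Real.norm_eq_abs]
          refine norm_integral_le_of_norm_le (hNint j) ?_
          refine ae_restrict_of_forall_mem (hSmeas j) fun τ hτ => ?_
          have hd := hdef j τ hτ
          calc ‖⟪ψ j τ, dα • Rcol j τ - D j τ⟫_ℝ‖ ≤ ‖ψ j τ‖ * ‖dα • Rcol j τ - D j τ‖ := norm_inner_le_norm _ _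
            _ ≤ ‖ψ j τ‖ * L := by
                refine mul_le_mul_of_nonneg_left ?_ (norm_nonneg _)
                rw [← norm_neg, neg_sub]
                simpa [hD, hRcol] using hd
      _ = L * Mψ := by
          rw [hMψ, Finset.mul_sum]
          refine Finset.sum_congr rfl fun j _ => ?_
          rw [integral_mul_const, mul_comm]
  have h2e : |∑ i, ⟪e i, dα • Rcol (ι i) (t i) - D (ι i) (t i)⟫_ℝ| ≤ L * Me := by
    calc |∑ i, ⟪e i, dα • Rcol (ι i) (t i) - D (ι i) (t i)⟫_ℝ|
        ≤ ∑ i, |⟪e i, dα • Rcol (ι i) (t i) - D (ι i) (t i)⟫_ℝ| := Finset.abs_sum_le_sum_abs _ _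
      _ ≤ ∑ i, ‖e i‖ * L := by
          refine Finset.sum_le_sum fun i _ => ?_
          have hd := hdef (ι i) (t i) (hint_t i)
          exact abs_inner_atom_le (by simpa [hD, hRcol] using hd)
      _ = L * Me := by
          rw [hMe, Finset.mul_sum]
          refine Finset.sum_congr rfl fun i _ => ?_
          rw [mul_comm]
  have h2 : |(∑ j, ∫ τ in S j, ⟪ψ j τ, dα • Rcol j τ - D j τ⟫_ℝ) + ∑ i, ⟪e i, dα • Rcol (ι i) (t i) - D (ι i) (t i)⟫_ℝ| ≤ L * M := by
    calc |(∑ j, ∫ τ in S j, ⟪ψ j τ, dα • Rcol j τ - D j τ⟫_ℝ) + ∑ i, ⟪e i, dα • Rcol (ι i) (t i) - D (ι i) (t i)⟫_ℝ|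
        ≤ |∑ j, ∫ τ in S j, ⟪ψ j τ, dα • Rcol j τ - D j τ⟫_ℝ| + |∑ i, ⟪e i, dα • Rcol (ι i) (t i) - D (ι i) (t i)⟫_ℝ| := abs_add_le _ _
      _ ≤ L * Mψ + L * Me := add_le_add h2ψ h2e
      _ = L * M := by rw [hM]; ring
  -- (3) conclude
  have hMpos' : 0 < M := by simpa [hM, hMψ, hMe, hS] using hMpos
  have hpair' : √Γ / cnd * M ≤ P := by simpa [hM, hMψ, hMe, hP, hPψ, hPe, hS, hRcol] using hpair
  have hΓ0 : 0 ≤ √Γ / cnd * M := mul_nonneg (div_nonneg (Real.sqrt_nonneg _) hcnd.le) hMpos'.le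
  have hPpos : 0 ≤ P := le_trans hΓ0 hpair'
  have h3' : |dα| * (√Γ / cnd * M) ≤ L * M := by
    calc |dα| * (√Γ / cnd * M) ≤ |dα| * P := mul_le_mul_of_nonneg_left hpair' (abs_nonneg _)
      _ = |dα * P| := by rw [abs_mul, abs_of_nonneg hPpos]
      _ = |(∑ j, ∫ τ in S j, ⟪ψ j τ, dα • Rcol j τ - D j τ⟫_ℝ) + ∑ i, ⟪e i, dα • Rcol (ι i) (t i) - D (ι i) (t i)⟫_ℝ| := by rw [h1]
      _ ≤ L * M := h2
  have h4 : |dα| * √Γ / cnd ≤ L := by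
    have h5 : (|dα| * √Γ / cnd) * M ≤ L * M := by
      calc (|dα| * √Γ / cnd) * M = |dα| * (√Γ / cnd * M) := by ring
        _ ≤ L * M := h3'
    exact le_of_mul_le_mul_right h5 hMpos'
  calc |dα| * √Γ = cnd * (|dα| * √Γ / cnd) := by field_simp
    _ ≤ cnd * L := mul_le_mul_of_nonneg_left h4 hcnd.le

end Summit.NavierStokesRegularity.NavierStokesRegularity.Theorems.Clause13REdgeMeasureCertificate

end
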